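import Literature.AnabelianGeometry.SemiGraphs.PSCSeparatingCoveringsSmoothCurve
import Literature.AnabelianGeometry.SemiGraphs.PSCCuspidalCriterionSmoothCurveOrigin
import HarnessLib

/-!
# [CombGC] Prop. 1.2, proof p. 9, edge case at smooth curves: ANY representatives of the cuspidal conjugacy classes (rows F-2827, F-2829)

Mochizuki, *A combinatorial version of the Grothendieck conjecture* [CombGC], Def. 1.1 (ii) p. 6: "A vertex
(respectively, edge) of `𝔾` determines, UP TO CONJUGATION, a closed subgroup of `Π_G`"; proof of Prop. 1.2
p. 9 (edge case): "there exists a finite étale … `Π_G`-covering `G' → G` whose restriction to the anabelioid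
`G_{e₂}` is trivial …, but whose restriction to the anabelioid `G_{e₁}` is nontrivial"
[cite: MochizukiCombGC2007, Prop 1.2 proof p.9].  PROOF-ONLY sequel of
`PSCSeparatingCoveringsSmoothCurve.lean` (abc-iut FACT-LIST rows F-2827 `EdgeLikeSeparatingCoverings`,
F-2829 `SeparatingCoverings` at genuine smooth-curve data).  There the datum's cusp groups were normalised
to be EXACTLY the closed cusp inertia groups `closure ι⟨c_j⟩` of the pro-`Σ` completion
`ι : Γ_{g,r} → Π`; the interface `PSCDatum` (and print) only fixes ONE representative of each conjugacy
class.  Here: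

* `exists_separating_cuspInertia` — the separating covering as a statement of PURE PROFINITE GROUP
  THEORY about a pro-`Σ` completion `ι : Γ_{g,r} → Π` of a hyperbolic punctured surface group (`Π`
  profinite), with no `PSCDatum` in the statement: for `V ⊴ Π` open, cusps `j₁, j₂`, elements `x₁, x₂`
  with `j₁ ≠ j₂` or `V x₁ Ī_{j₁} ≠ V x₂ Ī_{j₂}` (`Ī_j := closure ι⟨c_j⟩`), an open `U ≤ V` normal in `V`
  contains `x₂ Ī_{j₂} x₂⁻¹ ∩ V` and not `x₁ Ī_{j₁} x₁⁻¹ ∩ V` (from the `PSCDatum` theorem applied to the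
  auxiliary one-vertex datum);
* `exists_edgeSeparating_of_smoothCurve'`, `edgeLikeSeparatingCoverings_of_smoothCurve'` (**F-2827**),
  `separatingCoverings_of_smoothCurve'` (**F-2829**) — the same rows at smooth-curve data whose cusp
  groups are ARBITRARY representatives `δ_c · closure ι⟨c_{e c}⟩ · δ_c⁻¹` of the cuspidal conjugacy
  classes (faithful to Def. 1.1 (ii); e.g. the representatives a covering datum `G.restrictBD U` picks).

0 definitions; instance forms at genuine data, not the multi-component statement; nothing here takes a
side on [IUTchIII] Cor. 3.12.
-/

noncomputable section

namespace Literature.AnabelianGeometry.SemiGraphs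

namespace PSCDatum

open scoped Pointwise
open Literature.GroupTheory.CombinatorialGroupTheory
open Literature.GroupTheory.CombinatorialGroupTheory.PuncturedSurfaceGroup (cuspInertia IsHyperbolicType)
open SemiGraphOfAnabelioids (IsProSigmaCompletion)

universe u

variable {P : Type u} [Group P] [TopologicalSpace P] [IsTopologicalGroup P]

/-! ### Double cosets with a conjugated right group -/

omit [TopologicalSpace P] [IsTopologicalGroup P] in
/-- `y ∈ V x (dΠd⁻¹)` iff `y d ∈ V (x d) Π`: the cusps `V \ Π / dΠ_cd⁻¹` of a covering computed with the
representative `dΠ_cd⁻¹` are the cusps `V \ Π / Π_c` translated by `d`.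
[cite: MochizukiCombGC2007, Def 1.1(ii) p.6] -/
theorem mem_doubleCoset_conjAct_smul_iff (x d y : P) (V A : Subgroup P) :
    y ∈ DoubleCoset.doubleCoset x (V : Set P) ((ConjAct.toConjAct d • A : Subgroup P) : Set P) ↔
      y * d ∈ DoubleCoset.doubleCoset (x * d) (V : Set P) (A : Set P) := by
  constructor
  · intro hy
    obtain ⟨v, hv, p', hp', rfl⟩ := DoubleCoset.mem_doubleCoset.mp hy
    have hp : d⁻¹ * p' * d ∈ A := by
      rw [SetLike.mem_coe, Subgroup.mem_pointwise_smul_iff_inv_smul_mem, ← map_inv, ConjAct.smul_def,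
        ConjAct.ofConjAct_toConjAct, inv_inv] at hp'
      exact hp'
    exact DoubleCoset.mem_doubleCoset.mpr ⟨v, hv, d⁻¹ * p' * d, hp, by group⟩
  · intro hy
    obtain ⟨v, hv, p, hp, hyd⟩ := DoubleCoset.mem_doubleCoset.mp hy
    refine DoubleCoset.mem_doubleCoset.mpr ⟨v, hv, d * p * d⁻¹, ?_, ?_⟩
    · rw [SetLike.mem_coe, Subgroup.mem_pointwise_smul_iff_inv_smul_mem, ← map_inv, ConjAct.smul_def,
        ConjAct.ofConjAct_toConjAct, inv_inv]
      simpa [mul_assoc] using hp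
    · calc y = y * d * d⁻¹ := by group
        _ = v * (x * d) * p * d⁻¹ := by rw [hyd]
        _ = v * x * (d * p * d⁻¹) := by group

omit [TopologicalSpace P] [IsTopologicalGroup P] in
/-- Equal cusps for the representative `Π_c` give equal cusps for the representative `dΠ_cd⁻¹`.
[cite: MochizukiCombGC2007, Def 1.1(ii) p.6] -/
theorem doubleCoset_conjAct_smul_eq_of_eq {x₁ x₂ d : P} {V A : Subgroup P}
    (h : DoubleCoset.doubleCoset (x₁ * d) (V : Set P) (A : Set P) =
      DoubleCoset.doubleCoset (x₂ * d) (V : Set P) (A : Set P)) :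
    DoubleCoset.doubleCoset x₁ (V : Set P) ((ConjAct.toConjAct d • A : Subgroup P) : Set P) =
      DoubleCoset.doubleCoset x₂ (V : Set P) ((ConjAct.toConjAct d • A : Subgroup P) : Set P) := by
  ext y
  rw [mem_doubleCoset_conjAct_smul_iff, mem_doubleCoset_conjAct_smul_iff, h]

/-! ### The separating covering as pure profinite group theory -/

section SmoothCurve

variable [CompactSpace P] [TotallyDisconnectedSpace P]
variable {Sigma : Set ℕ} {g r : ℕ}

/-- **[CombGC] Prop. 1.2 proof p. 9 (edge case) as a statement about a pro-`Σ` surface group, no datum in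
the statement.**  Let `ι : Γ_{g,r} → Π` be a pro-`Σ` completion of a hyperbolic punctured surface group
(`Π` profinite), `Ī_j := closure ι⟨c_j⟩` the closed cusp inertia groups, `V ⊴ Π` open, and `(j₁, x₁)`,
`(j₂, x₂)` with `j₁ ≠ j₂` or `V x₁ Ī_{j₁} ≠ V x₂ Ī_{j₂}` (two distinct cusps of the covering surface attached
to `V`).  Then some open `U ≤ V`, normal in `V`, contains `x₂ Ī_{j₂} x₂⁻¹ ∩ V` and does not contain
`x₁ Ī_{j₁} x₁⁻¹ ∩ V`.  (`exists_edgeSeparating_of_smoothCurve` for the auxiliary one-vertex datum with cusp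
groups `Ī_j`.) [cite: MochizukiCombGC2007, Prop 1.2 proof p.9] -/
theorem exists_separating_cuspInertia (hne : Sigma.Nonempty) (hprime : ∀ p ∈ Sigma, p.Prime)
    (h : IsHyperbolicType g r) (ι : PuncturedSurfaceGroup g r →* P) (hι : IsProSigmaCompletion Sigma ι)
    (V : Subgroup P) [V.Normal] (hVo : IsOpen (V : Set P)) (j₁ j₂ : Fin r) (x₁ x₂ : P)
    (hne12 : j₁ ≠ j₂ ∨
      DoubleCoset.doubleCoset x₁ (V : Set P)
          ((((cuspInertia (g := g) j₁).map ι).topologicalClosure : Subgroup P) : Set P) ≠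
        DoubleCoset.doubleCoset x₂ (V : Set P)
          ((((cuspInertia (g := g) j₂).map ι).topologicalClosure : Subgroup P) : Set P)) :
    ∃ U : Subgroup P, IsOpen (U : Set P) ∧ U ≤ V ∧ (U.subgroupOf V).Normal ∧
      (ConjAct.toConjAct x₂ • ((cuspInertia (g := g) j₂).map ι).topologicalClosure) ⊓ V ≤ U ∧
      ¬ ((ConjAct.toConjAct x₁ • ((cuspInertia (g := g) j₁).map ι).topologicalClosure) ⊓ V ≤ U) := by
  -- the auxiliary one-vertex datum of smooth-curve shape with these cusp groups
  let G₀ : PSCDatum P :=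
    { Sigma := Sigma
      sigma_prime := hprime
      sigma_nonempty := hne
      graph := { V := Unit, N := Empty, C := Fin r, nodeEnds := Empty.elim, cuspEnd := fun _ => () }
      vertGp := fun _ => ⊤
      nodeGp := Empty.elim
      cuspGp := fun j => ((cuspInertia (g := g) j).map ι).topologicalClosure
      genus := fun _ => 0
      isClosed_vertGp := fun _ => by rw [Subgroup.coe_top]; exact isClosed_univ
      isClosed_nodeGp := fun e => e.elim
      isClosed_cuspGp := fun _ => Subgroup.isClosed_topologicalClosure _
      nodeGp_le := fun e => e.elim
      cuspGp_le := fun _ => ⟨1, le_top⟩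
      proSigma := isProSigma_of_isProSigmaCompletion hι }
  have key := G₀.exists_edgeSeparating_of_smoothCurve hne hprime h ι hι (Equiv.refl _) (fun _ => rfl) V hVo
    j₁ j₂ (ConjAct.toConjAct x₁) (ConjAct.toConjAct x₂)
    (by simpa only [ConjAct.ofConjAct_toConjAct] using hne12)
  exact key

/-- **Level form at smooth-curve data with ARBITRARY cusp representatives.**  As
`exists_edgeSeparating_of_smoothCurve`, for a datum whose cusp group at `c` is SOME conjugate
`δ_c · closure ι⟨c_{e c}⟩ · δ_c⁻¹` of the closed cusp inertia group (Def. 1.1 (ii): "determines, up to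
conjugation, a closed subgroup"). [cite: MochizukiCombGC2007, Prop 1.2 proof p.9] -/
theorem exists_edgeSeparating_of_smoothCurve' (hne : Sigma.Nonempty) (hprime : ∀ p ∈ Sigma, p.Prime)
    (h : IsHyperbolicType g r) (ι : PuncturedSurfaceGroup g r →* P) (hι : IsProSigmaCompletion Sigma ι)
    (G : PSCDatum P) (e : G.graph.C ≃ Fin r)
    (hC : ∀ c, ∃ δ : P, G.cuspGp c =
      ConjAct.toConjAct δ • ((cuspInertia (g := g) (e c)).map ι).topologicalClosure)
    (V : Subgroup P) [V.Normal] (hVo : IsOpen (V : Set P)) (c₁ c₂ : G.graph.C) (γ₁ γ₂ : ConjAct P)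
    (hne12 : c₁ ≠ c₂ ∨
      DoubleCoset.doubleCoset (ConjAct.ofConjAct γ₁) (V : Set P) (G.cuspGp c₁ : Set P) ≠
        DoubleCoset.doubleCoset (ConjAct.ofConjAct γ₂) (V : Set P) (G.cuspGp c₂ : Set P)) :
    ∃ U : Subgroup P, IsOpen (U : Set P) ∧ U ≤ V ∧ (U.subgroupOf V).Normal ∧
      (γ₂ • G.cuspGp c₂) ⊓ V ≤ U ∧ ¬ ((γ₁ • G.cuspGp c₁) ⊓ V ≤ U) := by
  choose δ hδ using hC
  have hne' : e c₁ ≠ e c₂ ∨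
      DoubleCoset.doubleCoset (ConjAct.ofConjAct γ₁ * δ c₁) (V : Set P)
          ((((cuspInertia (g := g) (e c₁)).map ι).topologicalClosure : Subgroup P) : Set P) ≠
        DoubleCoset.doubleCoset (ConjAct.ofConjAct γ₂ * δ c₂) (V : Set P)
          ((((cuspInertia (g := g) (e c₂)).map ι).topologicalClosure : Subgroup P) : Set P) := by
    by_cases hc : c₁ = c₂
    · subst hc
      refine hne12.imp (fun hn _ => hn rfl) (fun hdc heq => hdc ?_)
      rw [hδ c₁]
      exact doubleCoset_conjAct_smul_eq_of_eq heq
    · exact Or.inl (fun hj => hc (e.injective hj))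
  have h₁ : γ₁ • G.cuspGp c₁ = ConjAct.toConjAct (ConjAct.ofConjAct γ₁ * δ c₁) •
      ((cuspInertia (g := g) (e c₁)).map ι).topologicalClosure := by
    rw [hδ c₁, ← mul_smul, map_mul, ConjAct.toConjAct_ofConjAct]
  have h₂ : γ₂ • G.cuspGp c₂ = ConjAct.toConjAct (ConjAct.ofConjAct γ₂ * δ c₂) •
      ((cuspInertia (g := g) (e c₂)).map ι).topologicalClosure := by
    rw [hδ c₂, ← mul_smul, map_mul, ConjAct.toConjAct_ofConjAct]
  rw [h₁, h₂]
  exact exists_separating_cuspInertia hne hprime h ι hι V hVo (e c₁) (e c₂) _ _ hne'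

/-- **Row F-2827 at smooth-curve data with arbitrary cusp representatives** (one vertex, no nodes, `Π`
profinite, cusp groups conjugates of the closed cusp inertia groups of a pro-`Σ` completion of a
hyperbolic `Γ_{g,r}`). [cite: MochizukiCombGC2007, Prop 1.2 proof p.9] -/
theorem edgeLikeSeparatingCoverings_of_smoothCurve' (hne : Sigma.Nonempty) (hprime : ∀ p ∈ Sigma, p.Prime)
    (h : IsHyperbolicType g r) (ι : PuncturedSurfaceGroup g r →* P) (hι : IsProSigmaCompletion Sigma ι)
    (G : PSCDatum P) (e : G.graph.C ≃ Fin r)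
    (hC : ∀ c, ∃ δ : P, G.cuspGp c =
      ConjAct.toConjAct δ • ((cuspInertia (g := g) (e c)).map ι).topologicalClosure)
    [IsEmpty G.graph.N] : G.EdgeLikeSeparatingCoverings := by
  intro V hVn hVo
  haveI := hVn
  refine ⟨V, hVn, hVo, le_rfl, fun e₁ e₂ γ₁ γ₂ hne12 => ?_⟩
  rcases e₁ with n | c₁
  · exact isEmptyElim n
  rcases e₂ with n | c₂
  · exact isEmptyElim n
  exact G.exists_edgeSeparating_of_smoothCurve' hne hprime h ι hι e hC V hVo c₁ c₂ γ₁ γ₂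
    (hne12.imp (fun hn hc => hn (by rw [hc])) id)

/-- **Row F-2829 at smooth-curve data with arbitrary cusp representatives** (one vertex with `Π_v = Π`).
[cite: MochizukiCombGC2007, Prop 1.2 proof p.9] -/
theorem separatingCoverings_of_smoothCurve' (hne : Sigma.Nonempty) (hprime : ∀ p ∈ Sigma, p.Prime)
    (h : IsHyperbolicType g r) (ι : PuncturedSurfaceGroup g r →* P) (hι : IsProSigmaCompletion Sigma ι)
    (G : PSCDatum P) (e : G.graph.C ≃ Fin r)
    (hC : ∀ c, ∃ δ : P, G.cuspGp c =
      ConjAct.toConjAct δ • ((cuspInertia (g := g) (e c)).map ι).topologicalClosure)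
    [IsEmpty G.graph.N] (hV : ∀ v, G.vertGp v = ⊤) (v₀ : G.graph.V) (hv : ∀ w, w = v₀) :
    G.SeparatingCoverings :=
  ⟨G.verticialSeparatingCoverings_of_vertGp_eq_top hV v₀ hv,
    G.edgeLikeSeparatingCoverings_of_smoothCurve' hne hprime h ι hι e hC,
    G.unrVerticialSeparatingCoverings_of_vertGp_eq_top hV v₀ hv⟩

end SmoothCurve

end PSCDatum

end Literature.AnabelianGeometry.SemiGraphs

end
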